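import Summits.ResolutionOfSingularities.ResolutionOfSingularities.Theses.HomologicalConductor
import Summits.ResolutionOfSingularities.ResolutionOfSingularities.Theorems.HomologicalConductorNoZenoBirthDefs
import Summits.ResolutionOfSingularities.ResolutionOfSingularities.Theorems.HomologicalConductorNoZenoTowerNoetherian
import Summits.ResolutionOfSingularities.ResolutionOfSingularities.Theorems.HomologicalConductorNoZenoDim2RegularCentre
import Summits.ResolutionOfSingularities.ResolutionOfSingularities.Theorems.HomologicalConductorNoZenoKernelLowDim
import Summits.ResolutionOfSingularities.ResolutionOfSingularities.Theorems.SyzygyFlatteningHigherRankTerminationLocAt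
import Summits.ResolutionOfSingularities.ResolutionOfSingularities.Theorems.SyzygyFlatteningHigherRankTerminationUnionDichotomy
import Summits.ResolutionOfSingularities.ResolutionOfSingularities.Theorems.SyzygyFlatteningHigherRankTerminationResidueTrdegCases
import Literature.AlgebraicGeometry.Resolution.DominatedUnions
import Literature.AlgebraicGeometry.Resolution.PrimeDivisors
import Literature.AlgebraicGeometry.Resolution.TranscendenceDefect
import Literature.AlgebraicGeometry.Resolution.RankOneReductionProofs

/-!
# Crux `NoZeno` (stmt-ResolutionOfSingularities-16483) — the surface tower dichotomy, and
# KERNEL Case B is EMPTY in dimension 2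

Route `ResolutionOfSingularities/HomologicalConductor`, crux
`Summit.ResolutionOfSingularities.ResolutionOfSingularities.Theses.HomologicalConductor.NoZeno`,
line `birth`, open stub `stub_kernelRankOne` (rank-one `O`, maximal dominator, NO noetherian
valuation ring skeleton-dominates the tower, `2 ≤ tr.deg`). Negative lane (`--supports` the crux
item): no Theses decl is asserted; OURS (res-L0-w44-tri-1, BARRIER & DEFECT triage calibration).

* `surfaceTower_dichotomy` — UNCONDITIONAL (no `Persistence`, no `StrictDrop`, ANY valuation ring
  `O ∋ k` with `A ⊆ O`), `tr.deg_k K ≤ 2`: EITHER the canonical normalised `ca`-tower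
  `T_m = tower O A m` EXHAUSTS `O` (every element of `O` lies in some stage), OR a PRIME DIVISOR
  `W` of `K/k` (`W ∋ k`, `W ≠ K`, `residueTrdeg W + 1 = tr.deg`, hence a discrete valuation ring
  by Zariski–Samuel VI §14 Thm 31) skeleton-dominates the tower — contains every stage, and a
  stage element inverted in `W` is inverted in `O` — so that by the landed
  `stub_dominanceInvariance` the `O`-tower IS the `W`-tower. Proof: a `t ∈ O` outside all stages
  has `t⁻¹` outside all stages (stages are `locAt`-closed); Abhyankar's Lemma 7
  (`exists_valuationSubring_dominates_of_chain'`) on the normal local dominated chain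
  `T₁ ⊆ T₂ ⊆ ⋯` gives `W ∋ t` dominating every stage with `t̄` residually transcendental over `k`;
  `W ≠ K` since `T₁ ∌ t` is not a field; `ratRank W ≥ 1`, `residueTrdeg W ≥ 1` and Abhyankar's
  inequality `ratRank + residueTrdeg ≤ tr.deg ≤ 2` force `residueTrdeg W + 1 = tr.deg`.
* `surfaceKernel_exhausts` — under the verbatim kernel hypothesis `hker` of `stub_kernelRankOne`
  and `tr.deg_k K ≤ 2` the tower EXHAUSTS `O` (KERNEL.md Case A); i.e. KERNEL Case B ("the union
  of the stages is not a valuation ring") is EMPTY on surfaces — correcting `Cruxes/NoZeno/KERNEL-c1.md`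
  §6 ("both Case A and Case B remain possible a priori"). Hence on a surface `O` in the kernel is
  rank one, zero-dimensional and non-discrete, and the kernel splits into the Abhyankar habitat
  (rational rank 2, transcendence defect 0) and the DEFECT habitat (rational rank 1, value group
  not finitely generated, residue field algebraic, transcendence defect 1).

For the support statement `SurfaceTermination` (stmt-ResolutionOfSingularities-16488) the
dichotomy splits the surface case into towers along prime divisors and EXHAUSTIVE towers along
non-divisorial `O`.

Kernel-only (axioms `propext`, `Classical.choice`, `Quot.sound`); no `def`, no named fact.
-/

set_option linter.dupNamespace false

noncomputable section

namespace Summit.ResolutionOfSingularities.ResolutionOfSingularities.Theorems.NoZeno.Negative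

open Summit.ResolutionOfSingularities.ResolutionOfSingularities.Theorems
open Summit.ResolutionOfSingularities.ResolutionOfSingularities.Theorems.NoZeno.Birth
open Literature.AlgebraicGeometry.Resolution Polynomial

variable {k K : Type} [Field k] [Field K] [Algebra k K]

/-- Every stage of the `ca`-tower is `locAt O B` for some model `B ⊆ O`. [folklore] -/
theorem std_tower_eq_locAt (O : ValuationSubring K) (A : Subalgebra k K)
    (hk : ∀ c : k, algebraMap k K c ∈ O) (hA : A.FG) (hfr : IsFractionRing ↥A K)
    (hAO : A.toSubring ≤ O.toSubring) (m : ℕ) :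
    ∃ B : Subalgebra k K, tower O A m = SyzygyFlattening.locAt O B ∧
      B.toSubring ≤ O.toSubring := by
  cases m with
  | zero => exact ⟨A, rfl, hAO⟩
  | succ n =>
    refine ⟨nrm (chart O (tower O A n)), rfl, ?_⟩
    have hTO := (tn_tower_invariant O A hk hA hfr hAO (n + 1)).2.1
    exact fun x hx => hTO (SyzygyFlattening.self_le_locAt O _ hx)

/-- Stages are closed under inverting `O`-units. [folklore] -/
theorem std_inv_mem_tower_of_inv_mem (O : ValuationSubring K) (A : Subalgebra k K)
    (hk : ∀ c : k, algebraMap k K c ∈ O) (hA : A.FG) (hfr : IsFractionRing ↥A K)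
    (hAO : A.toSubring ≤ O.toSubring) (m : ℕ) {s : K}
    (hs : s ∈ tower O A m) (hsO : s⁻¹ ∈ O) : s⁻¹ ∈ tower O A m := by
  obtain ⟨B, hB, hBO⟩ := std_tower_eq_locAt O A hk hA hfr hAO m
  have h := SyzygyFlattening.mul_inv_mem_locAt O (tower O A m) (tower O A m).one_mem hs hsO
  rwa [one_mul, hB, SyzygyFlattening.locAt_locAt O B hBO, ← hB] at h

/-- Stages are local rings. [folklore] -/
theorem std_isLocalRing_tower (O : ValuationSubring K) (A : Subalgebra k K)
    (hk : ∀ c : k, algebraMap k K c ∈ O) (hA : A.FG) (hfr : IsFractionRing ↥A K)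
    (hAO : A.toSubring ≤ O.toSubring) (m : ℕ) : IsLocalRing ↥(tower O A m) := by
  obtain ⟨B, hB, hBO⟩ := std_tower_eq_locAt O A hk hA hfr hAO m
  rw [hB]
  exact SyzygyFlattening.isLocalRing_locAt O B hBO

/-- One step up the tower (membership form, successor syntax). [folklore] -/
theorem std_mem_tower_succ_of_mem (O : ValuationSubring K) (A : Subalgebra k K) (m : ℕ) {x : K}
    (hx : x ∈ tower O A m) : x ∈ tower O A (m + 1) := by
  rw [tower_succ]
  exact SyzygyFlattening.self_le_locAt O _ (SyzygyFlattening.self_le_nrm _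
    (Algebra.subset_adjoin (Or.inl hx)))

/-- **Surface tower dichotomy (OURS; unconditional, no `P`/`D`, any valuation ring `O`).** In
transcendence degree `≤ 2`, EITHER the canonical normalised `ca`-tower along `O` EXHAUSTS `O`
(every element of `O` lies in some stage), OR some PRIME DIVISOR `W` of `K/k` — a valuation ring
`W ∋ k`, `W ≠ K`, of dimension `tr.deg - 1`, hence a discrete valuation ring (Zariski–Samuel VI
§14 Thm 31) — skeleton-dominates the tower (contains every stage, and a stage element inverted
in `W` is inverted in `O`), so that by `stub_dominanceInvariance` the `O`-tower IS the `W`-tower.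
Proof: a `t ∈ O` outside all stages has `t⁻¹` outside all stages (stages are `locAt`-closed);
Abhyankar's Lemma 7 on the normal local dominated chain `T₁ ⊆ T₂ ⊆ ⋯` gives `W ∋ t` dominating
every stage with `t̄` residually transcendental over `k`; `W ≠ K` because `T₁ ∌ t` is not a field;
`ratRank W ≥ 1`, `residueTrdeg W ≥ 1` and Abhyankar's inequality `ratRank + residueTrdeg ≤ tr.deg ≤ 2`
force `residueTrdeg W + 1 = tr.deg`.
[cite: Abhyankar1956Valuations, Lemma 7] [cite: ZariskiSamuel1960, Ch. VI §14, Thm. 31] -/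
theorem surfaceTower_dichotomy (O : ValuationSubring K) (A : Subalgebra k K)
    (hk : ∀ c : k, algebraMap k K c ∈ O) (hA : A.FG) (hfr : IsFractionRing ↥A K)
    (hAO : A.toSubring ≤ O.toSubring) (htr : Algebra.trdeg k K ≤ 2) :
    (∀ t : K, t ∈ O → ∃ m : ℕ, t ∈ tower O A m) ∨
      ∃ (W : ValuationSubring K) (hkW : ∀ c : k, algebraMap k K c ∈ W), W ≠ ⊤ ∧
        IsDiscreteValuationRing ↥W ∧ residueTrdeg k W hkW + 1 = Algebra.trdeg k K ∧
        ∀ m : ℕ, ∀ s ∈ tower O A m, s ∈ W ∧ (s⁻¹ ∈ W → s⁻¹ ∈ O) := by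
  classical
  by_cases hU : ∀ t : K, t ∈ O → ∃ m : ℕ, t ∈ tower O A m
  · exact Or.inl hU
  right
  push Not at hU
  obtain ⟨t, htO, ht⟩ := hU
  haveI : IsFractionRing ↥A K := hfr
  haveI : Algebra.FiniteType k ↥A := A.fg_iff_finiteType.mp hA
  have hfg : (⊤ : IntermediateField k K).FG :=
    IntermediateField.fg_top_of_isFractionRing_of_finiteType k ↥A K
  -- stage facts
  have hAT : ∀ m, A ≤ tower O A m := fun m => (tn_tower_invariant O A hk hA hfr hAO m).1
  have hTO : ∀ m, (tower O A m).toSubring ≤ O.toSubring :=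
    fun m => (tn_tower_invariant O A hk hA hfr hAO m).2.1
  have hinv : ∀ m {s : K}, s ∈ tower O A m → s⁻¹ ∈ O → s⁻¹ ∈ tower O A m :=
    fun m _ hs hsO => std_inv_mem_tower_of_inv_mem O A hk hA hfr hAO m hs hsO
  -- the chain of normal local stages `R i = T (i + 1)`
  let R : ℕ → Subring K := fun i => (tower O A (i + 1)).toSubring
  have hloc : ∀ i, IsLocalRing (R i) := fun i => std_isLocalRing_tower O A hk hA hfr hAO (i + 1)
  have hdom : ∀ i, SubringDominates (R i) (R (i + 1)) := fun i =>
    ⟨fun x hx => std_mem_tower_succ_of_mem O A (i + 1) hx,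
      fun x hx hxinv => hinv (i + 1) hx (hTO (i + 1 + 1) hxinv)⟩
  have hfrR : ∀ i, IsFractionRing (R i) K := fun i =>
    isFractionRing_subalgebra_of_le A (tower O A (i + 1)) (hAT (i + 1))
  have hint : ∀ i, IsIntegrallyClosedIn (R i) K := fun i => by
    haveI : IsIntegrallyClosed (R i) :=
      d2rc_isIntegrallyClosed_tower_succ O A hk hA hfr hAO i
    haveI : IsFractionRing (R i) K := hfrR i
    exact (isIntegrallyClosed_iff_isIntegrallyClosedIn K).mp ‹IsIntegrallyClosed ↥(R i)›
  have htR : ∀ i, t ∉ R i := fun i h => ht (i + 1) h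
  have htR' : ∀ i, t⁻¹ ∉ R i := fun i h => ht (i + 1) (by
    have h' := hinv (i + 1) h (by rw [inv_inv]; exact htO)
    rwa [inv_inv] at h')
  -- Abhyankar's Lemma 7
  obtain ⟨W, htW, hWdom, hpoly⟩ :=
    exists_valuationSubring_dominates_of_chain' R hloc hdom hint htR htR'
  have hkW : ∀ c : k, algebraMap k K c ∈ W := fun c => (hWdom 0).1 (hAT 1 (A.algebraMap_mem c))
  -- `W` skeleton-dominates the tower
  have hWsk : ∀ m : ℕ, ∀ s ∈ tower O A m, s ∈ W ∧ (s⁻¹ ∈ W → s⁻¹ ∈ O) := by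
    intro m s hs
    have hs' : s ∈ R m := std_mem_tower_succ_of_mem O A m hs
    exact ⟨(hWdom m).1 hs', fun h => hTO (m + 1) ((hWdom m).2 s hs' h)⟩
  -- `W ≠ K`: otherwise `T₁` would be a field with fraction field `K`, containing `t`
  have hWtop : W ≠ ⊤ := by
    rintro rfl
    haveI := hfrR 0
    obtain ⟨a, b, -, hab⟩ := IsFractionRing.div_surjective (A := ↥(R 0)) t
    have hab' : t = (a : K) * ((b : K))⁻¹ := by rw [← hab, div_eq_mul_inv]; rfl
    apply htR 0
    rw [hab']
    by_cases hb0 : (b : K) = 0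
    · rw [hb0, inv_zero, mul_zero]
      exact (R 0).zero_mem
    · exact (R 0).mul_mem a.2 ((hWdom 0).2 (b : K) b.2 (ValuationSubring.mem_top _))
  -- residual transcendence of `t̄`, and the numerical invariants of `W`
  have hndz : ¬ SyzygyFlattening.DimZero k W :=
    SyzygyFlattening.not_dimZero_of_residually_transcendental W (R 0)
      (fun c => hAT 1 (A.algebraMap_mem c)) htW (hpoly 0)
  letI : Algebra k W := algebraOfMem k W hkW
  haveI : IsScalarTower k W K := isScalarTower_algebraOfMem k W hkW
  have hN := trdeg_lt_aleph0_of_fg hfg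
  obtain ⟨n, hn⟩ := Cardinal.lt_aleph0.mp hN
  obtain ⟨e, he⟩ := Cardinal.lt_aleph0.mp (ratRank_lt_aleph0 W hkW hN)
  obtain ⟨f, hf⟩ := Cardinal.lt_aleph0.mp (residueTrdeg_lt_aleph0 W hkW hN)
  have hf1 : 1 ≤ f := by
    by_contra hf0
    push Not at hf0
    have hf0' : f = 0 := by omega
    subst hf0'
    haveI : Algebra.IsAlgebraic k (IsLocalRing.ResidueField W) :=
      trdeg_eq_zero_iff.mp (by rw [← residueTrdeg_eq W hkW, hf]; rfl)
    exact hndz (SyzygyFlattening.residueTrdeg_cases_dimZero W)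
  have he1 : 1 ≤ e := by
    have h := one_le_ratRank_of_ne_top W hWtop
    rw [he] at h
    exact_mod_cast h
  have hsum : e + f ≤ n := by
    have h := ratRank_add_residueTrdeg_le_trdeg W hkW
    rw [he, hf, hn] at h
    exact_mod_cast h
  have hn2 : n ≤ 2 := by
    rw [hn] at htr
    exact_mod_cast htr
  have hF : residueTrdeg k W hkW + 1 = Algebra.trdeg k K := by
    rw [hf, hn]
    have : f + 1 = n := by omega
    exact_mod_cast this
  exact ⟨W, hkW, hWtop, isDiscreteValuationRing_of_residueTrdeg W hkW hfg hWtop hF, hF, hWsk⟩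

/-- **Surface kernel exhaustion (KERNEL Case B is empty in dimension 2).** Under the kernel
hypothesis `hker` of `stub_kernelRankOne` (no noetherian valuation ring skeleton-dominates the
tower) and `tr.deg_k K ≤ 2`, the tower EXHAUSTS `O`: the prime divisor of the dichotomy is a
DVR, hence noetherian. [cite: ZariskiSamuel1960, Ch. VI §14, Thm. 31] -/
theorem surfaceKernel_exhausts (O : ValuationSubring K) (A : Subalgebra k K)
    (hk : ∀ c : k, algebraMap k K c ∈ O) (hA : A.FG) (hfr : IsFractionRing ↥A K)
    (hAO : A.toSubring ≤ O.toSubring)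
    (hker : ∀ O' : ValuationSubring K,
      (∀ m : ℕ, ∀ s ∈ tower O A m, s ∈ O' ∧ (s⁻¹ ∈ O' → s⁻¹ ∈ O)) → ¬ IsNoetherianRing ↥O')
    (htr : Algebra.trdeg k K ≤ 2) :
    ∀ t : K, t ∈ O → ∃ m : ℕ, t ∈ tower O A m := by
  rcases surfaceTower_dichotomy O A hk hA hfr hAO htr with h | ⟨W, -, -, hdvr, -, hWsk⟩
  · exact h
  · haveI := hdvr
    exact absurd (inferInstance : IsNoetherianRing ↥W) (hker W hWsk)

end Summit.ResolutionOfSingularities.ResolutionOfSingularities.Theorems.NoZeno.Negative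

end
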